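/-
Copyright: lit-balaban cell, Phase-2 proof seat p33 (gen 7).  Statement-level skeleton of a published paper; no proof claims beyond
what the kernel checks below.
-/
import Literature.MathematicalPhysics.QuantumFieldTheory.BalabanImbrieJaffe1984to88.BIJ85Claim73Residual

/-!
# `BalabanImbrieJaffe1984to88.BIJ85ResidualMinimizer` — T. Bałaban, J. Imbrie, A. Jaffe, *Renormalization of the Higgs model:
minimizers, propagators and the stability of mean field theory*, Commun. Math. Phys. **97** (1985) 299–329
[BalabanImbrieJaffe1985]: **the residual field (4.2.6) of an EXACT unit-lattice field is the curvature of the minimizer** —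
`f_k = (I − ∂G_{k,Ax}∂^*)Q^{e*}_k∂B = ∂H_{k,Ax}B = ∂H_kB` ON THE TORI, from (5.3.1) `H_{k,Ax}B = Q^{s*}_kB − G_{k,Ax}∂^*Q^{e*}_k∂B` (p30's
`BIJ85Eq625Torus.HaxE_eq_531`), `∂Q^{s*}_k = Q^{e*}_k∂` (`BIJ85Eq611Torus.curlOp_QsE`) and (5.2.8) `∂H_{k,Ax} = ∂H_k` (p11's
`BIJ85Prop522Torus.curlOp_comp_HaxE`).  Consequence for SKELETON row **C1.Eq7.3.1-7.3.2** (file D of this seat's gen-7 member; files A–C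
`BIJ85Eq454PlaqResidual`, `BIJ85Claim73Residual`, `BIJ85Claim73ActualOne`): on exact fields the located input of file B — the sup-norm
property `|f_k| ≤ K_R·max|f|` of the residual operator (index field `ResIdx.hR`) — IS the gauge-invariant sup-norm regularity
`‖∂H_kB‖_∞ ≤ K_R‖∂B‖_∞` of the Landau minimizer (4.4.2), i.e. the territory of the gradient member of (7.2.2), row C1.Eq7.2.1-7.2.2
(p. 325: *"The kernel H_{k,μν}(x,y) and its gradient decay exponentially"*).

statement-level skeleton of published theorems with citation tags; proofs where landed; nothing here is a claim about the Yang–Mills mass gap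

PDF held: `paper:balaban1985-cmp97-bij-higgs-minimizers` (journal page = PDF page + 298).  Pages read this session: p. 311 [PDF 13] ((4.2.6),
(4.3.1)–(4.3.2)), p. 316–317 [PDF 18–19] ((5.2.8), (5.3.1)), p. 325 [PDF 27] ((7.2.1)–(7.2.2)).

CITATION HEADER (lean-in-tree rule).  Phase-2 file of the lit-balaban TYPED SKELETON (HOME `run/shared/lean/pub/lit-balaban/`), seat p33 gen 7
(unit `lit-balaban-p33-g7`).  Objects BY NAME: file A's `resE`, p11's `HaxE`/`HkE`/`curlOp_comp_HaxE`, p30's `QsE`/`dOne`/`HaxE_eq_531`/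
`curlOp_QsE`/`axialPropagator_eq_GaxE`, p09's `curlG`.  Theorems only; no `def`, no named fact (D-0026).

THE PRINTED TEXT, verbatim.  p. 311 [PDF 13]: *"f_k ≡ (I − ∂G_{k,Ax}∂^*)Q^{e*}_kf, (4.2.6) … exp(−½⟨∂B, σ_k∂B⟩) = Z_{k,Ax}^{−1}∫𝒟Aδ(Q_kA)
δ_{k,Ax}(A)exp(−½‖∂A − Q^{e*}_k∂B‖²) = Z_{k,Ax}^{−1}∫𝒟Aδ(Q_kA − B)δ_{k,Ax}(A)exp(−½‖∂A‖²) … we use ∂Q^{s*}_k = Q^{e*}_k∂ (4.3.2)"*; p. 317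
[PDF 19]: *"H_{k,Ax}B = Q^{s*}_kB − G_{k,Ax}∂^*Q^{e*}_k∂B. (5.3.1)"*; p. 316 [PDF 18]: *"the fact that H^*_{j,Ax}∂^* = H^*_j∂^*, (5.2.8) is gauge
invariant"*.

WHAT IS PROVED (0 `sorry`, standard axioms).  `resE_dOne_eq_curlOp_HaxE` (`f_k(∂B) = ∂H_{k,Ax}B`), **`resE_dOne_eq_curlOp_HkE`**
(`f_k(∂B) = ∂H_kB`, the Landau minimizer), `norm_curlOp_HkE_sq` (`‖∂H_kB‖² = ⟨∂B, σ_k∂B⟩`, (4.3.1)–(4.3.2) for the Landau minimizer), and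
**`hR_exact_iff`**: the residual property of file B on the exact fields `∂B` is EQUIVALENT to `|(∂H_kB)(p)|·… ≤ K_R√w·C` whenever
`|(∂B)(q)| ≤ C` — the located input named as a property of `H_k` alone.
HONEST SCOPE.  Identities; the bound itself (for general `k`) is NOT proved here (row C1.Eq7.2.1-7.2.2's ∇H member for the ACTUAL `H_k`, plus a
local axial gauge); non-exact (harmonic) unit-lattice fields are not covered by this identification.  Standing range `k ≤ m + K`, `c ≠ 0`,
`w > 0`, `2 ≤ d`.
-/

open scoped RealInnerProductSpace BigOperators

namespace Literature.MathematicalPhysics.QuantumFieldTheory.BalabanImbrieJaffe1984to88.BIJ85ResidualMinimizer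

open Literature.MathematicalPhysics.QuantumFieldTheory.Balaban1983to89
open BIJ85AxialPropagator411 (BondSpace PlaqSpace curlOp V411 axialPropagator)
open BIJ85Prop521Torus (CoarseSpace QsE)
open BIJ85Prop522Torus (HaxE HkE GaxE curlOp_comp_HaxE)
open BIJ85SigmaForm421 (curlG)
open BIJ85Sigma421Torus (toU QesOp UnitPlaqSpace sigmaTorus)
open BIJ85Eq611Torus (dOne curlOp_QsE)
open BIJ85Eq625Torus (HaxE_eq_531 axialPropagator_eq_GaxE)
open BIJ85Eq454PlaqResidual (resE norm_resE_sq)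

noncomputable section

variable {P : Params}

/-- **`f_k(∂B) = ∂H_{k,Ax}B`**: the residual field (4.2.6) of the exact unit-lattice field `∂B` (`dOne P k c B`, factor `c/L^k`) is the
curvature of the axial minimizer — `Q^{e*}_k∂B = ∂Q^{s*}_kB` ((4.3.2)) and `(I − ∂G_{k,Ax}∂^*)∂Q^{s*}_kB = ∂(Q^{s*}_kB − G_{k,Ax}∂^*Q^{e*}_k∂B) =
∂H_{k,Ax}B` ((5.3.1)); `k ≤ m + K`, `c ≠ 0`, `w > 0`, `2 ≤ d`. [cite: BalabanImbrieJaffe1985, (5.3.1) p.317] -/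
theorem resE_dOne_eq_curlOp_HaxE (hd : 2 ≤ P.d) {k : ℕ} (hk : k ≤ P.m + P.K) {c : ℝ} (hc : c ≠ 0) {w : ℝ} (hw : 0 < w)
    (B : CoarseSpace P k) :
    resE hd w c k (dOne P k c B) = curlOp (P := P) w c (HaxE P w c k B) := by
  have h1 : QesOp (P := P) hd w k (dOne P k c B) = curlOp (P := P) w c (QsE P k B) := by
    have h := LinearMap.congr_fun (curlOp_QsE hd hk w c) B
    simpa only [LinearMap.comp_apply] using h.symm
  rw [resE, h1, HaxE_eq_531 hd hk hc hw, curlG, axialPropagator_eq_GaxE hc hw hk]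
  simp only [LinearMap.sub_apply, LinearMap.comp_apply, map_sub, h1]

/-- **`f_k(∂B) = ∂H_kB` — the residual field of an exact field is the curvature of the LANDAU minimizer (4.4.2)** (`HaxE` replaced by
`HkE` through (5.2.8) `∂H_{k,Ax} = ∂H_k`, p11's `curlOp_comp_HaxE`); `k ≤ m + K`, `c ≠ 0`, `w > 0`, `2 ≤ d`.
[cite: BalabanImbrieJaffe1985, (5.2.8) p.316] -/
theorem resE_dOne_eq_curlOp_HkE (hd : 2 ≤ P.d) {k : ℕ} (hk : k ≤ P.m + P.K) {c : ℝ} (hc : c ≠ 0) {w : ℝ} (hw : 0 < w)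
    (B : CoarseSpace P k) :
    resE hd w c k (dOne P k c B) = curlOp (P := P) w c (HkE P w c k B) := by
  rw [resE_dOne_eq_curlOp_HaxE hd hk hc hw B]
  have h := LinearMap.congr_fun (curlOp_comp_HaxE hk hc hw) B
  simpa only [LinearMap.comp_apply] using h

/-- **(4.3.1)–(4.3.2) for the Landau minimizer**: `⟨∂B, σ_k∂B⟩ = ‖∂H_kB‖²` (the torus σ_k of record; (4.2.7) `⟨f, σ_kf⟩ = ‖f_k‖²` at `f = ∂B`
with `f_k = ∂H_kB`); `k ≤ m + K`, `c ≠ 0`, `w > 0`, `2 ≤ d`. [cite: BalabanImbrieJaffe1985, (4.3.2) p.311] -/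
theorem norm_curlOp_HkE_sq (hd : 2 ≤ P.d) {k : ℕ} (hk : k ≤ P.m + P.K) {c : ℝ} (hc : c ≠ 0) {w : ℝ} (hw : 0 < w)
    (B : CoarseSpace P k) :
    ‖curlOp (P := P) w c (HkE P w c k B)‖ ^ 2 = ⟪dOne P k c B, sigmaTorus (P := P) hd w c k (dOne P k c B)⟫ := by
  rw [← resE_dOne_eq_curlOp_HkE hd hk hc hw B, norm_resE_sq hd hk hc hw]

/-- **The located input of file B ON EXACT FIELDS is a property of `H_k` alone**: for `w = η^d`, `c = η⁻¹` (or any `c ≠ 0`, `w > 0`) and a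
constant `K`, the residual bound `|resE(∂B)(p)| ≤ K√w·C` for all `B` with `|(∂B)(q)| ≤ C` is EQUIVALENT to the sup-norm regularity
`|(√w·∂H_kB)(p)| ≤ K√w·C` of the Landau minimizer's curvature under the same hypothesis — the gauge-invariant form of the gradient member of
(7.2.2) (p. 325: *"The kernel H_{k,μν}(x,y) and its gradient decay exponentially"*). [cite: BalabanImbrieJaffe1985, (7.2.2) p.325] -/
theorem hR_exact_iff (hd : 2 ≤ P.d) {k : ℕ} (hk : k ≤ P.m + P.K) {c : ℝ} (hc : c ≠ 0) {w : ℝ} (hw : 0 < w) (K : ℝ) :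
    (∀ (B : CoarseSpace P k) (C : ℝ), (∀ q, |dOne P k c B q| ≤ C) →
        ∀ p : Balaban1983to89.Plaq P 0, |resE hd w c k (dOne P k c B) p| ≤ K * Real.sqrt w * C) ↔
      (∀ (B : CoarseSpace P k) (C : ℝ), (∀ q, |dOne P k c B q| ≤ C) →
        ∀ p : Balaban1983to89.Plaq P 0, |curlOp (P := P) w c (HkE P w c k B) p| ≤ K * Real.sqrt w * C) := by
  constructor
  · intro h B C hB p
    rw [← resE_dOne_eq_curlOp_HkE hd hk hc hw B]
    exact h B C hB p
  · intro h B C hB p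
    rw [resE_dOne_eq_curlOp_HkE hd hk hc hw B]
    exact h B C hB p

end

end Literature.MathematicalPhysics.QuantumFieldTheory.BalabanImbrieJaffe1984to88.BIJ85ResidualMinimizer
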